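import Mathlib.Data.ZMod.Basic
import Mathlib.Data.Nat.Bitwise
import Mathlib.Tactic.Linarith
import Mathlib.Tactic.Ring
import Mathlib.Tactic.Push
import Literature.Computability.Complexity.CircuitComposition
import Literature.Computability.AlgebraicComplexity.ArithCircuit
import HarnessLib

/-!
# Boolean simulation of arithmetic modulo `p` (Bürgisser 2000, §5 (A3), last step)

Trunk T-CPLX-ALG / CplxCore toolkit. This file supplies the last, GRH-free step of the proof of
Bürgisser's `BP(VP_k) ⊆ FP/poly` (TCS 235 (2000), Thm. 1.1(1), §5 (A3), p. 86): "We remark that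
the addition and multiplication in `𝔽_p` can be performed by (uniform) Boolean circuits of size
`(log p)^{O(1)}` and depth `O(log log p)` (cf. Karp and Ramachandran [14, Section 4.2.2]). Using
this, we see that we can simulate the straight-line program `Γ_n` in `𝔽_{p_n}` with constants
`y^{(n)}` by a Boolean circuit `C_n` satisfying `size(C_n) = (log p_n)^{O(1)} · size(Γ_n) = n^{O(1)}`
[…]. The circuit `C_n` computes a bit representation of `F_n(x, y^{(n)}) ∈ 𝔽_{p_n}` on input
`x ∈ {0,1}ⁿ`. (We can think of `p_n` and `y^{(n)}` as being "hard-wired" in `C_n`.)" For the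
`FP/poly` form of (A3) vendored in `BurgisserBooleanParts.lean` only the size bound matters, and
we realise it by the school methods (no depth bound is claimed).

Concretely we prove (`cktSize_testBits_aeval_eval`): if `P` is a fan-in-two arithmetic circuit
over `ℤ` in variables `τ`, `p ≤ 2^ℓ` is a modulus, and every variable `v : τ` is fed, as a
function of the Boolean inputs `x : ι → Bool`, an element `z x v ∈ ZMod p` whose `ℓ` bits have
`B₂`-circuits of size `cz`, then the `ℓ` bits of `(aeval (z x) P.eval).val` — the value of `P` at
`z x` reduced modulo `p` — have `B₂`-circuits of size `(P.size + 1) · gateCost ℓ cz`, where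
`gateCost` is a polynomial of degree `3` in `ℓ` (modular multiplication by `ℓ` Horner steps of
modular doubling/addition, modular addition by two binary adders, a comparison and a
multiplexer row; binary addition by `W` carry-save iterations `(x, y) ↦ (x ⊕ y, (x ∧ y) ≪ 1)`).

## The bookkeeping device `CktSizeVia`

`CktSizeVia e f s` (for a *bus* `e : θ → (α → Bool)` and a target `f : θ → (κ → Bool)` indexed by
an arbitrary parameter type `θ`) says that some single straight-line program of size `s` maps
`e t` to `f t` for every parameter `t` — a circuit statement whose specification is only
required on the image of the encoding `e` (e.g. on bit vectors that are binary representations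
of residues `< p`). It specialises to `CktSize B2 f s` for `e = id` and composes sequentially
(`trans`), in parallel (`pair`), along reparametrisations (`reparam`) and under iteration of a
parameter map (`iterate`), which is all the plumbing the simulation needs.

## References

* P. Bürgisser, *Cook's versus Valiant's hypothesis*, Theoret. Comput. Sci. 235 (2000) 71–88,
  §5 (A3), p. 86.
* H. Vollmer, *Introduction to Circuit Complexity*, Springer 1999, §1.1 (binary addition by
  circuits), §1.2 (composition of straight-line programs).
* T. H. Cormen, C. E. Leiserson, R. L. Rivest, C. Stein, *Introduction to Algorithms*, 3rd ed.,
  MIT Press 2009, §31.6 (MODULAR-EXPONENTIATION: the double-and-add / square-and-multiply loop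
  and its invariant; used here additively for modular multiplication).
* R. M. Karp, V. Ramachandran, *Parallel algorithms for shared-memory machines*, Handbook of
  TCS Vol. A (1990), Ch. 17, §4.2.2 (Bürgisser's reference [14] for Boolean circuits for
  arithmetic in `𝔽_p`).
-/

noncomputable section

open Literature.Computability.AlgebraicComplexity

namespace Literature.Computability.AlgebraicComplexity

universe u

/-! ### Circuits reading a bus: `CktSizeVia` -/

section Via

variable {θ θ' α κ κ' μ : Type*}

/-- `CktSizeVia e f s`: there is ONE `B₂`-straight-line program with at most `s` gates which, fed
the bus `e t : α → Bool`, outputs `f t : κ → Bool`, for every parameter `t : θ` (a circuit for `f`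
"reading the wires `e`", specified only on the image of `e`; Vollmer 1999, §1.2, composition of
straight-line programs). For `e = id` this is `CktSize B2 f s` (`toCktSize`). [cite: Vollmer1999, §1.2] -/
def CktSizeVia (e : θ → α → Bool) (f : θ → κ → Bool) (s : ℕ) : Prop :=
  ∃ F : (α → Bool) → κ → Bool, Complexity.CktSize Complexity.B2 F s ∧ ∀ t, F (e t) = f t

namespace CktSizeVia

variable {e : θ → α → Bool} {f : θ → κ → Bool} {s s' : ℕ}

/-- A genuine circuit for `F` computes `f` from any bus on which `F` restricts to `f`. [folklore] -/
theorem of_cktSize {F : (α → Bool) → κ → Bool} (h : Complexity.CktSize Complexity.B2 F s) (hf : ∀ t, F (e t) = f t) :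
    CktSizeVia e f s :=
  ⟨F, h, hf⟩

/-- Reading the identity bus is an ordinary circuit. [folklore] -/
theorem toCktSize {f : (α → Bool) → κ → Bool} (h : CktSizeVia (fun a : α → Bool => a) f s) :
    Complexity.CktSize Complexity.B2 f s := by
  obtain ⟨F, hF, hf⟩ := h
  exact hF.congr fun x k => by rw [hf]

/-- An ordinary circuit reads the identity bus. [folklore] -/
theorem of_cktSize_id {f : (α → Bool) → κ → Bool} (h : Complexity.CktSize Complexity.B2 f s) :
    CktSizeVia (fun a : α → Bool => a) f s :=
  ⟨f, h, fun _ => rfl⟩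

/-- Monotonicity in the size bound. [folklore] -/
theorem of_le (h : CktSizeVia e f s) (hs : s ≤ s') : CktSizeVia e f s' := by
  obtain ⟨F, hF, hf⟩ := h
  exact ⟨F, hF.of_le hs, hf⟩

/-- Changing the target pointwise on the parameters. [folklore] -/
theorem congr {g : θ → κ → Bool} (h : CktSizeVia e f s) (hfg : ∀ t, f t = g t) :
    CktSizeVia e g s := by
  obtain ⟨F, hF, hf⟩ := h
  exact ⟨F, hF, fun t => (hf t).trans (hfg t)⟩

/-- Changing the bus pointwise on the parameters. [folklore] -/
theorem congr_bus {e' : θ → α → Bool} (h : CktSizeVia e f s) (hee : ∀ t, e t = e' t) :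
    CktSizeVia e' f s := by
  obtain ⟨F, hF, hf⟩ := h
  exact ⟨F, hF, fun t => by rw [← hee, hf]⟩

/-- Reading wires of the bus costs nothing. [folklore] -/
theorem proj (e : θ → α → Bool) (π : κ → α) : CktSizeVia e (fun t k => e t (π k)) 0 :=
  of_cktSize (Complexity.CktSize.proj Complexity.B2 π) fun _ => rfl

/-- Renaming outputs is free. [folklore] -/
theorem outMap (h : CktSizeVia e f s) (r : κ' → κ) : CktSizeVia e (fun t k' => f t (r k')) s := by
  obtain ⟨F, hF, hf⟩ := h
  exact ⟨fun a k' => F a (r k'), hF.outMap r, fun t => funext fun k' => by simp only [hf]⟩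

/-- Parallel composition on the same bus: sizes add (Vollmer 1999, §1.2). [cite: Vollmer1999, §1.2] -/
theorem pair {g : θ → κ' → Bool} (hf : CktSizeVia e f s) (hg : CktSizeVia e g s') :
    CktSizeVia e (fun t => Sum.elim (f t) (g t)) (s + s') := by
  obtain ⟨F, hF, hf⟩ := hf
  obtain ⟨G, hG, hg⟩ := hg
  exact ⟨fun a => Sum.elim (F a) (G a), hF.pair hG, fun t => by simp only [hf, hg]⟩

/-- Sequential composition: what is computed from `f` is computed from any bus computing `f`
(Vollmer 1999, §1.2). [cite: Vollmer1999, §1.2] -/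
theorem trans {g : θ → μ → Bool} (hf : CktSizeVia e f s) (hg : CktSizeVia f g s') :
    CktSizeVia e g (s + s') := by
  obtain ⟨F, hF, hf⟩ := hf
  obtain ⟨G, hG, hg⟩ := hg
  exact ⟨fun a => G (F a), hF.comp hG, fun t => by simp only [hf, hg]⟩

/-- Reparametrisation: the same program works along any map of parameters. [folklore] -/
theorem reparam (h : CktSizeVia e f s) (r : θ' → θ) :
    CktSizeVia (fun t' => e (r t')) (fun t' => f (r t')) s := by
  obtain ⟨F, hF, hf⟩ := h
  exact ⟨F, hF, fun t' => hf (r t')⟩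

/-- Extending the bus by computed wires. [folklore] -/
theorem extend (h : CktSizeVia e f s) : CktSizeVia e (fun t => Sum.elim (e t) (f t)) s := by
  have := (proj e _root_.id).pair h
  rwa [Nat.zero_add] at this

/-- Iterating a parameter map whose effect on the bus is computed by `s` gates costs `m · s`
gates for `m` rounds (Arora–Barak 2009, proof of Thm. 6.6: one layer per step). [cite: AroraBarakCC2009, Thm. 6.6] -/
theorem iterate {σ : θ → θ} (h : CktSizeVia e (fun t => e (σ t)) s) :
    ∀ m : ℕ, CktSizeVia e (fun t => e (σ^[m] t)) (m * s)
  | 0 => by simpa using proj e _root_.id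
  | m + 1 => by
    have h1 := (iterate h m).trans (h.reparam fun t => σ^[m] t)
    rw [Nat.succ_mul]
    exact h1.congr fun t => by rw [Function.iterate_succ_apply']

/-- A target without outputs costs nothing. [folklore] -/
theorem of_isEmpty [IsEmpty κ] (e : θ → α → Bool) (f : θ → κ → Bool) (s : ℕ) :
    CktSizeVia e f s :=
  (of_cktSize (Complexity.CktSize.of_isEmpty Complexity.B2 fun (_ : α → Bool) (k : κ) => isEmptyElim k)
    fun _ => funext fun k => isEmptyElim k).of_le (Nat.zero_le _)

/-- An ordinary circuit on inputs `x` reads any bus whose first block is `x`. [folklore] -/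
theorem of_cktSize_inl {ι β : Type*} {f : (ι → Bool) → κ → Bool} (h : Complexity.CktSize Complexity.B2 f s)
    (g : (ι → Bool) → β → Bool) :
    CktSizeVia (fun x : ι → Bool => Sum.elim x (g x)) f s :=
  of_cktSize (h.rewire Sum.inl) fun _ => rfl

/-- Bundling single-output programs over a finite output type: `card κ · s` gates
(Vollmer 1999, §1.2). [cite: Vollmer1999, §1.2] -/
theorem pi_const [Fintype κ] (h : ∀ k, CktSizeVia e (fun t (_ : Unit) => f t k) s) :
    CktSizeVia e f (Fintype.card κ * s) := by
  choose F hF hf using h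
  refine of_cktSize (Complexity.CktSize.pi_const (f := fun a k => F k a ()) fun k => ?_) fun t => ?_
  · exact (hF k).congr fun _ _ => rfl
  · funext k
    rw [hf]

/-- One binary gate reading two wires of the bus (every binary Boolean operation is in `B₂`;
Vollmer 1999, §1.1). [cite: Vollmer1999, §1.1] -/
theorem binop (e : θ → α → Bool) (op : Bool → Bool → Bool) (i j : α) :
    CktSizeVia e (fun t (_ : Unit) => op (e t i) (e t j)) 1 := by
  refine of_cktSize (F := fun a (_ : Unit) => op (a i) (a j)) ?_ fun _ => rfl
  exact (Complexity.CktSize.gate (B := Complexity.B2) (ι := α) ⟨2, fun v => op (v 0) (v 1)⟩ (by simp [Complexity.B2]) ![i, j]).congr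
    fun x _ => by simp

/-- A row of binary gates, one per output (Vollmer 1999, §1.1). [cite: Vollmer1999, §1.1] -/
theorem map₂ [Fintype κ] (e : θ → α → Bool) (op : Bool → Bool → Bool) (π₁ π₂ : κ → α) :
    CktSizeVia e (fun t k => op (e t (π₁ k)) (e t (π₂ k))) (Fintype.card κ * 1) :=
  pi_const fun k => binop e op (π₁ k) (π₂ k)

/-- A row of constants, one gate per output (Vollmer 1999, §1.1). [cite: Vollmer1999, §1.1] -/
theorem constRow [Fintype κ] (e : θ → α → Bool) (b : κ → Bool) :
    CktSizeVia e (fun _ => b) (Fintype.card κ * 1) :=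
  pi_const fun k => of_cktSize (Complexity.cktSize_const α (b k)) fun _ => rfl

/-- A row of multiplexers `(c ∧ a) ∨ (¬ c ∧ b)`, four gates per output (Vollmer 1999, §1.2). [cite: Vollmer1999, §1.2] -/
theorem muxRow [Fintype κ] (e : θ → α → Bool) (c a b : κ → α) :
    CktSizeVia e (fun t k => (e t (c k) && e t (a k) || !e t (c k) && e t (b k)))
      (Fintype.card κ * 4) :=
  pi_const fun k => of_cktSize (Complexity.cktSize_mux (c k) (a k) (b k)) fun _ => rfl

end CktSizeVia

end Via

/-! ### Binary representations -/

/-- The `w` low-order bits of `N`: `testBits w N i = N.testBit i` (binary representation, least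
significant bit first; Vollmer 1999, §1.1). [cite: Vollmer1999, §1.1] -/
def testBits (w : ℕ) (N : ℕ) : Fin w → Bool := fun i => N.testBit i

/-- Unfolding of `testBits`. [folklore] -/
@[simp] theorem testBits_apply (w N : ℕ) (i : Fin w) : testBits w N i = N.testBit i := rfl

/-- The low `w` bits only depend on the residue modulo `2 ^ w`. [folklore] -/
theorem testBits_mod (w N : ℕ) : testBits w (N % 2 ^ w) = testBits w N := by
  funext i
  simp [testBits, i.2]

/-- The bits of `0` are all `false`. [folklore] -/
@[simp] theorem testBits_zero (w : ℕ) : testBits w 0 = fun _ => false := by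
  funext i
  simp [testBits]

/-! ### Binary addition by carry-save iteration -/

/-- School identity behind carry-save addition: `x + y = (x ⊕ y) + 2 (x ∧ y)` (sum bits plus
shifted carry bits; Vollmer 1999, §1.1). [cite: Vollmer1999, §1.1] -/
theorem add_eq_xor_add_two_mul_and : ∀ x y : ℕ, x + y = (x ^^^ y) + 2 * (x &&& y) := by
  intro x
  induction x using Nat.binaryRec with
  | zero => intro y; simp
  | bit a m ih =>
    intro y
    induction y using Nat.binaryRec with
    | zero => simp
    | bit b n _ =>
      rw [Nat.land_bit, Nat.xor_bit, Nat.bit_val, Nat.bit_val, Nat.bit_val, Nat.bit_val]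
      have := ih n
      cases a <;> cases b <;> simp <;> omega

/-- Masking by a multiple of `2 ^ m` kills the low `m` bits. [folklore] -/
theorem two_pow_dvd_and_of_dvd {m b : ℕ} (a : ℕ) (h : 2 ^ m ∣ b) : 2 ^ m ∣ (a &&& b) := by
  rw [Nat.dvd_iff_mod_eq_zero] at h ⊢
  apply Nat.eq_of_testBit_eq
  intro i
  have hb := congrArg (fun n => n.testBit i) h
  simp only [Nat.testBit_mod_two_pow, Nat.zero_testBit, Bool.and_eq_false_imp,
    decide_eq_true_eq] at hb
  simp only [Nat.testBit_mod_two_pow, Nat.testBit_and, Nat.zero_testBit]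
  by_cases hi : i < m
  · simp [hb hi]
  · simp [hi]

/-- One carry-save round on a pair of `W`-bit numbers: `(x, y) ↦ (x ⊕ y, (2 (x ∧ y)) mod 2^W)`
(Vollmer 1999, §1.1). [cite: Vollmer1999, §1.1] -/
def csStep (W : ℕ) (xy : ℕ × ℕ) : ℕ × ℕ := (xy.1 ^^^ xy.2, (xy.1 &&& xy.2) * 2 ^ 1 % 2 ^ W)

/-- The bus of a carry-save state: the bits of `x` followed by the bits of `y`. [folklore] -/
def csEnc (W : ℕ) (xy : ℕ × ℕ) : Fin W ⊕ Fin W → Bool := Sum.elim (testBits W xy.1) (testBits W xy.2)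

/-- One carry-save round costs `2 W` gates: `W` exclusive-ors, one constant and `W - 1`
conjunctions (Vollmer 1999, §1.1). [cite: Vollmer1999, §1.1] -/
theorem cktSizeVia_csStep (W : ℕ) :
    CktSizeVia (csEnc W) (fun xy => csEnc W (csStep W xy)) (W * 1 + W * 1) := by
  have hx : CktSizeVia (csEnc W) (fun xy (i : Fin W) => (csEnc W xy (.inl i) ^^ csEnc W xy (.inr i)))
      (W * 1) := by
    simpa using CktSizeVia.map₂ (csEnc W) (fun a b => a ^^ b) Sum.inl Sum.inr
  have hy : CktSizeVia (csEnc W) (fun xy (i : Fin W) =>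
      if h : (i : ℕ) = 0 then false
      else (csEnc W xy (.inl ⟨i - 1, by omega⟩) && csEnc W xy (.inr ⟨i - 1, by omega⟩))) (W * 1) := by
    have := CktSizeVia.pi_const (κ := Fin W) (e := csEnc W) (s := 1)
      (f := fun xy (i : Fin W) => if h : (i : ℕ) = 0 then false
        else (csEnc W xy (.inl ⟨i - 1, by omega⟩) && csEnc W xy (.inr ⟨i - 1, by omega⟩))) fun i => ?_
    · simpa using this
    by_cases h : (i : ℕ) = 0
    · simp only [h, ↓reduceDIte]
      exact CktSizeVia.of_cktSize (Complexity.cktSize_const _ false) fun _ => rfl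
    · simp only [h, ↓reduceDIte]
      exact CktSizeVia.binop (csEnc W) (fun a b => a && b) _ _
  refine (hx.pair hy).congr fun xy => ?_
  funext w
  rcases w with i | i
  · simp [csEnc, csStep, testBits]
  · simp only [csEnc, csStep, Sum.elim_inr, testBits_apply, Nat.testBit_mod_two_pow, i.2,
      decide_true, Bool.true_and, Nat.testBit_mul_two_pow, Nat.testBit_and]
    by_cases h : (i : ℕ) = 0
    · simp [h]
    · simp only [h, ↓reduceDIte, Sum.elim_inl, testBits_apply]
      rw [show decide (1 ≤ (i : ℕ)) = true from decide_eq_true (by omega), Bool.true_and]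

/-- Invariants of carry-save iteration: the sum modulo `2^W` is preserved and after `m ≤ W`
rounds the carry word is divisible by `2^m` (Vollmer 1999, §1.1). [cite: Vollmer1999, §1.1] -/
theorem csStep_iterate_inv (W : ℕ) (xy : ℕ × ℕ) :
    ∀ m, m ≤ W → (((csStep W)^[m] xy).1 + ((csStep W)^[m] xy).2) % 2 ^ W = (xy.1 + xy.2) % 2 ^ W ∧
      2 ^ m ∣ ((csStep W)^[m] xy).2
  | 0, _ => by simp
  | m + 1, hm => by
    obtain ⟨h1, h2⟩ := csStep_iterate_inv W xy m (Nat.le_of_succ_le hm)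
    rw [Function.iterate_succ_apply']
    set st := (csStep W)^[m] xy with hst
    refine ⟨?_, ?_⟩
    · rw [← h1]
      simp only [csStep, pow_one]
      rw [Nat.add_mod, Nat.mod_mod, ← Nat.add_mod, add_eq_xor_add_two_mul_and st.1 st.2, mul_comm]
    · simp only [csStep, pow_one]
      have h3 : 2 ^ (m + 1) ∣ (st.1 &&& st.2) * 2 := by
        rw [pow_succ]
        exact Nat.mul_dvd_mul_right (two_pow_dvd_and_of_dvd st.1 h2) 2
      exact (Nat.dvd_mod_iff (Nat.pow_dvd_pow 2 hm)).2 h3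

/-- **Binary addition** (Vollmer 1999, §1.1): `W` carry-save
rounds compute the `W` low bits of `x + y` from the bits of `x` and `y`, with `2 W²` gates.
[cite: Vollmer1999, §1.1] -/
theorem cktSizeVia_add (W : ℕ) :
    CktSizeVia (csEnc W) (fun xy => testBits W (xy.1 + xy.2)) (W * (W * 1 + W * 1)) := by
  refine (((cktSizeVia_csStep W).iterate W).outMap Sum.inl).congr fun xy => ?_
  obtain ⟨h1, h2⟩ := csStep_iterate_inv W xy W le_rfl
  set st := (csStep W)^[W] xy
  have h3 : st.1 % 2 ^ W = (xy.1 + xy.2) % 2 ^ W := by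
    rw [← h1, Nat.add_mod, Nat.mod_eq_zero_of_dvd h2]
    simp
  funext i
  simp only [csEnc, Sum.elim_inl]
  rw [← testBits_mod, h3, testBits_mod]

/-- Zero-extension by one bit: a number below `2 ^ ℓ` has bit `ℓ` equal to `0` (one constant
gate). [folklore] -/
theorem CktSizeVia.widen {θ α : Type*} {e : θ → α → Bool} {N : θ → ℕ} {ℓ s : ℕ}
    (h : CktSizeVia e (fun t => testBits ℓ (N t)) s) (hN : ∀ t, N t < 2 ^ ℓ) :
    CktSizeVia e (fun t => testBits (ℓ + 1) (N t)) (s + 1) := by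
  have h1 := h.pair (CktSizeVia.of_cktSize (e := e) (f := fun _ (_ : Unit) => false)
    (Complexity.cktSize_const α false) fun _ => rfl)
  refine (h1.outMap fun i : Fin (ℓ + 1) =>
    if hi : (i : ℕ) < ℓ then Sum.inl ⟨i, hi⟩ else Sum.inr ()).congr fun t => ?_
  funext i
  by_cases hi : (i : ℕ) < ℓ
  · simp [hi]
  · have hi' : (i : ℕ) = ℓ := by omega
    rw [dif_neg hi]
    simp only [Sum.elim_inr, testBits_apply, hi']
    exact (Nat.testBit_lt_two_pow (hN t)).symm

/-! ### Modular addition -/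

section ModArith

variable {p : ℕ} [NeZero p]

/-- The bus of a pair of residues: the `ℓ` bits of `a.val` followed by the `ℓ` bits of `b.val`. [folklore] -/
def zEnc₂ (ℓ : ℕ) (ab : ZMod p × ZMod p) : Fin ℓ ⊕ Fin ℓ → Bool :=
  Sum.elim (testBits ℓ ab.1.val) (testBits ℓ ab.2.val)

/-- Gate count of the modular adder on `ℓ`-bit residues. [folklore] -/
def modAddCost (ℓ : ℕ) : ℕ := 9 * (ℓ + 2) ^ 2

/-- Bits of `2 ^ j + x` for `x < 2 ^ j`: bit `j` is set and the lower bits are those of `x`. [folklore] -/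
theorem testBit_two_pow_add_of_lt {j x i : ℕ} (hx : x < 2 ^ j) :
    (2 ^ j + x).testBit i = if i = j then true else x.testBit i := by
  split_ifs with h
  · subst h
    rw [Nat.testBit_two_pow_add_eq, Nat.testBit_lt_two_pow hx]
    rfl
  · rcases lt_or_gt_of_ne h with h | h
    · exact Nat.testBit_two_pow_add_gt h x
    · rw [Nat.testBit_lt_two_pow, Nat.testBit_lt_two_pow]
      · exact hx.trans (Nat.pow_lt_pow_right (by norm_num) h)
      · calc 2 ^ j + x < 2 ^ j + 2 ^ j := by omega
          _ = 2 ^ (j + 1) := by rw [pow_succ]; ring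
          _ ≤ 2 ^ i := Nat.pow_le_pow_right (by norm_num) h

/-- **Modular addition** (school method: add, add `2^{ℓ+1} - p`, read the comparison off the top
bit, select; binary addition as in Vollmer 1999, §1.1): for a modulus `p ≤ 2^ℓ`, the `ℓ` bits of
`(a + b) mod p` are computed from the bits of the residues `a, b < p` by `modAddCost ℓ = O(ℓ²)`
gates. [folklore] -/
theorem modAddVia {ℓ : ℕ} (hℓ : p ≤ 2 ^ ℓ) :
    CktSizeVia (zEnc₂ (p := p) ℓ) (fun ab => testBits ℓ (ab.1 + ab.2).val) (modAddCost ℓ) := by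
  have hA : ∀ ab : ZMod p × ZMod p, ab.1.val < 2 ^ ℓ := fun ab => (ZMod.val_lt _).trans_le hℓ
  have hB : ∀ ab : ZMod p × ZMod p, ab.2.val < 2 ^ ℓ := fun ab => (ZMod.val_lt _).trans_le hℓ
  -- stage 1: the exact sum `S = a + b` on `ℓ + 1` bits
  have h1 : CktSizeVia (zEnc₂ (p := p) ℓ) (fun ab => csEnc (ℓ + 1) (ab.1.val, ab.2.val))
      (0 + 1 + (0 + 1)) :=
    ((CktSizeVia.proj (zEnc₂ (p := p) ℓ) Sum.inl).widen hA).pair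
      ((CktSizeVia.proj (zEnc₂ (p := p) ℓ) Sum.inr).widen hB)
  have h2 : CktSizeVia (zEnc₂ (p := p) ℓ) (fun ab => testBits (ℓ + 1) (ab.1.val + ab.2.val))
      (0 + 1 + (0 + 1) + (ℓ + 1) * ((ℓ + 1) * 1 + (ℓ + 1) * 1)) :=
    h1.trans ((cktSizeVia_add (ℓ + 1)).reparam fun ab : ZMod p × ZMod p => (ab.1.val, ab.2.val))
  have hS : ∀ ab : ZMod p × ZMod p, ab.1.val + ab.2.val < 2 ^ (ℓ + 1) := fun ab => by
    have := hA ab; have := hB ab; rw [pow_succ]; omega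
  -- the bus `bus1 = (a, b, S)`
  set bus1 : ZMod p × ZMod p → (Fin ℓ ⊕ Fin ℓ) ⊕ Fin (ℓ + 1) → Bool :=
    fun ab => Sum.elim (zEnc₂ ℓ ab) (testBits (ℓ + 1) (ab.1.val + ab.2.val)) with hbus1
  have h3 : CktSizeVia (zEnc₂ (p := p) ℓ) bus1 _ := h2.extend
  -- stage 2: `T = S + (2^(ℓ+1) - p)` on `ℓ + 2` bits
  set Q : ℕ := 2 ^ (ℓ + 1) - p with hQ
  have hQlt : Q < 2 ^ (ℓ + 2) := by
    have : 0 < p := Nat.pos_of_ne_zero (NeZero.ne p)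
    rw [hQ, pow_succ 2 (ℓ + 1)]; omega
  have h4 : CktSizeVia bus1 (fun ab => csEnc (ℓ + 2) (ab.1.val + ab.2.val, Q))
      (0 + 1 + Fintype.card (Fin (ℓ + 2)) * 1) :=
    ((CktSizeVia.proj bus1 Sum.inr).widen hS).pair (CktSizeVia.constRow bus1 (testBits (ℓ + 2) Q))
  have h5 : CktSizeVia bus1 (fun ab => testBits (ℓ + 2) (ab.1.val + ab.2.val + Q)) _ :=
    h4.trans ((cktSizeVia_add (ℓ + 2)).reparam fun ab : ZMod p × ZMod p => (ab.1.val + ab.2.val, Q))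
  set bus2 : ZMod p × ZMod p → ((Fin ℓ ⊕ Fin ℓ) ⊕ Fin (ℓ + 1)) ⊕ Fin (ℓ + 2) → Bool :=
    fun ab => Sum.elim (bus1 ab) (testBits (ℓ + 2) (ab.1.val + ab.2.val + Q)) with hbus2
  have h6 : CktSizeVia bus1 bus2 _ := h5.extend
  -- stage 3: select `T` or `S` according to the top bit of `T`
  have h7 : CktSizeVia bus2 (fun ab => testBits ℓ (ab.1 + ab.2).val) (Fintype.card (Fin ℓ) * 4) := by
    refine (CktSizeVia.muxRow bus2 (fun _ : Fin ℓ => Sum.inr ⟨ℓ + 1, by omega⟩)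
      (fun k => Sum.inr ⟨k, by omega⟩) (fun k => Sum.inl (Sum.inr ⟨k, by omega⟩))).congr fun ab => ?_
    funext k
    simp only [hbus2, hbus1, Sum.elim_inr, Sum.elim_inl, testBits_apply]
    set S := ab.1.val + ab.2.val with hSdef
    have hval : (ab.1 + ab.2).val = S % p := ZMod.val_add _ _
    rw [hval]
    by_cases hSp : S < p
    · -- no reduction: `T < 2^(ℓ+1)`, top bit `0`
      have hT : S + Q < 2 ^ (ℓ + 1) := by rw [hQ]; omega
      rw [Nat.testBit_lt_two_pow hT, Nat.mod_eq_of_lt hSp]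
      simp
    · -- reduction: `T = 2^(ℓ+1) + (S - p)` with `S - p < p ≤ 2^ℓ`
      push Not at hSp
      have hSlt : S < p + p := by
        rw [hSdef]; exact Nat.add_lt_add (ZMod.val_lt _) (ZMod.val_lt _)
      have hmod : S % p = S - p := by
        rw [Nat.mod_eq_sub_mod hSp, Nat.mod_eq_of_lt (by omega)]
      have hT : S + Q = 2 ^ (ℓ + 1) + (S - p) := by
        have : p ≤ 2 ^ (ℓ + 1) := hℓ.trans (Nat.pow_le_pow_right (by norm_num) (by omega))
        rw [hQ]; omega
      have hsub : S - p < 2 ^ (ℓ + 1) := by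
        have : S - p < 2 ^ ℓ := by omega
        exact this.trans (Nat.pow_lt_pow_right (by norm_num) (by omega))
      rw [hmod, hT, testBit_two_pow_add_of_lt hsub, testBit_two_pow_add_of_lt hsub]
      have hk : (k : ℕ) ≠ ℓ + 1 := by omega
      simp [hk]
  refine ((h3.trans (h6.trans h7)).of_le ?_)
  simp only [Fintype.card_fin, modAddCost]
  ring_nf
  nlinarith [sq_nonneg (ℓ : ℕ)]

/-- **`HasBits`**: the residues `v t ∈ ZMod p` are available in binary (`ℓ` bits of `(v t).val`)
from the bus `e` at cost `s`. [folklore] -/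
def HasBits (ℓ : ℕ) {θ α : Type*} (e : θ → α → Bool) (v : θ → ZMod p) (s : ℕ) : Prop :=
  CktSizeVia e (fun t => testBits ℓ (v t).val) s

namespace HasBits

variable {ℓ : ℕ} {θ α : Type*} {e : θ → α → Bool} {u v : θ → ZMod p} {s s' : ℕ}

omit [NeZero p] in
/-- Monotonicity in the size bound. [folklore] -/
theorem of_le (h : HasBits ℓ e v s) (hs : s ≤ s') : HasBits ℓ e v s' := CktSizeVia.of_le h hs

omit [NeZero p] in
/-- Pointwise equal residue functions have the same circuits. [folklore] -/
theorem congr (h : HasBits ℓ e u s) (huv : ∀ t, u t = v t) : HasBits ℓ e v s :=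
  CktSizeVia.congr h fun t => by rw [huv]

omit [NeZero p] in
/-- Constants cost `ℓ` constant gates. [folklore] -/
theorem const (ℓ : ℕ) (e : θ → α → Bool) (c : ZMod p) : HasBits ℓ e (fun _ => c) (ℓ * 1) := by
  have h := CktSizeVia.constRow e (testBits ℓ c.val)
  rw [Fintype.card_fin] at h
  exact h

omit [NeZero p] in
/-- Residues whose bits are wires of the bus cost nothing. [folklore] -/
theorem ofWires (π : Fin ℓ → α) (h : ∀ t i, e t (π i) = (v t).val.testBit i) : HasBits ℓ e v 0 :=
  (CktSizeVia.proj e π).congr fun t => funext fun i => h t i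

/-- Modular addition of available residues (school method, via `modAddVia`). [folklore] -/
theorem add (hℓ : p ≤ 2 ^ ℓ) (hu : HasBits ℓ e u s) (hv : HasBits ℓ e v s') :
    HasBits ℓ e (fun t => u t + v t) (s + s' + modAddCost ℓ) :=
  (CktSizeVia.pair hu hv).trans ((modAddVia hℓ).reparam fun t => (u t, v t))

end HasBits

/-! ### Modular multiplication by `ℓ` Horner steps -/

/-- The state bus of the modular multiplier: accumulator, shifted multiplier, multiplicand. [folklore] -/
def modMulEnc (ℓ : ℕ) (st : ZMod p × ℕ × ZMod p) : Fin ℓ ⊕ (Fin ℓ ⊕ Fin ℓ) → Bool :=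
  Sum.elim (testBits ℓ st.1.val) (Sum.elim (testBits ℓ st.2.1) (testBits ℓ st.2.2.val))

/-- One Horner step of double-and-add modular multiplication, most significant multiplier bit
(bit `ℓ - 1` of the shifted multiplier word) first: `acc ↦ 2 acc + b_{top} · a (mod p)`, shift the
multiplier word (CLRS 2009, §31.6, the loop of MODULAR-EXPONENTIATION, in its additive version). [cite: CLRS2009, §31.6 (MODULAR-EXPONENTIATION)] -/
def modMulStep (ℓ : ℕ) (st : ZMod p × ℕ × ZMod p) : ZMod p × ℕ × ZMod p :=
  (st.1 + st.1 + (if st.2.1.testBit (ℓ - 1) then st.2.2 else 0), st.2.1 * 2 ^ 1, st.2.2)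

/-- Gate count of one Horner step. [folklore] -/
def modMulStepCost (ℓ : ℕ) : ℕ := 2 * modAddCost ℓ + 2 * ℓ

/-- One Horner step is computed on the state bus by `modMulStepCost ℓ` gates. [folklore] -/
theorem cktSizeVia_modMulStep {ℓ : ℕ} (hℓ : p ≤ 2 ^ ℓ) :
    CktSizeVia (modMulEnc (p := p) ℓ) (fun st => modMulEnc ℓ (modMulStep ℓ st)) (modMulStepCost ℓ) := by
  have hacc : HasBits ℓ (modMulEnc (p := p) ℓ) (fun st => st.1) 0 :=
    HasBits.ofWires Sum.inl fun _ _ => rfl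
  have ha : HasBits ℓ (modMulEnc (p := p) ℓ) (fun st => st.2.2) 0 :=
    HasBits.ofWires (fun i => Sum.inr (Sum.inr i)) fun _ _ => rfl
  have hmask : HasBits ℓ (modMulEnc (p := p) ℓ)
      (fun st => if st.2.1.testBit (ℓ - 1) then st.2.2 else 0) (ℓ * 1) := by
    rcases Nat.eq_zero_or_pos ℓ with rfl | hpos
    · exact CktSizeVia.of_isEmpty _ _ _
    · have hm := CktSizeVia.map₂ (modMulEnc (p := p) ℓ) (fun c x => c && x)
        (fun _ : Fin ℓ => Sum.inr (Sum.inl ⟨ℓ - 1, by omega⟩)) (fun i => Sum.inr (Sum.inr i))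
      rw [Fintype.card_fin] at hm
      refine hm.congr fun st => ?_
      funext i
      simp only [modMulEnc, Sum.elim_inr, Sum.elim_inl, testBits_apply]
      cases st.2.1.testBit (ℓ - 1) <;> simp
  have hsum : HasBits ℓ (modMulEnc (p := p) ℓ)
      (fun st => st.1 + st.1 + (if st.2.1.testBit (ℓ - 1) then st.2.2 else 0)) _ :=
    (hacc.add hℓ hacc).add hℓ hmask
  have hshift : CktSizeVia (modMulEnc (p := p) ℓ) (fun st => testBits ℓ (st.2.1 * 2 ^ 1)) (ℓ * 1) := by
    refine (CktSizeVia.pi_const (κ := Fin ℓ) (e := modMulEnc (p := p) ℓ) (s := 1)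
      (f := fun st => testBits ℓ (st.2.1 * 2 ^ 1)) fun i => ?_).of_le (by simp)
    by_cases h : (i : ℕ) = 0
    · refine CktSizeVia.of_cktSize (Complexity.cktSize_const _ false) fun st => ?_
      funext u
      simp [h]
    · refine ((CktSizeVia.proj (modMulEnc (p := p) ℓ) fun _ : Unit =>
        Sum.inr (Sum.inl ⟨i - 1, by omega⟩)).congr fun st => ?_).of_le zero_le_one
      funext u
      simp only [modMulEnc, Sum.elim_inr, Sum.elim_inl, testBits_apply, Nat.testBit_mul_two_pow]
      rw [show decide (1 ≤ (i : ℕ)) = true from decide_eq_true (by omega), Bool.true_and]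
  exact ((hsum.pair (hshift.pair ha)).congr fun st => rfl).of_le
    (by simp only [modMulStepCost]; omega)

omit [NeZero p] in
/-- Semantics of the Horner iteration started at `(0, b, a)`: after `m ≤ ℓ` steps the accumulator
is `a · ⌊b / 2^{ℓ-m}⌋ mod p` and the multiplier word is `b · 2^m` (CLRS 2009, §31.6, loop
invariant of MODULAR-EXPONENTIATION, in its additive version). [cite: CLRS2009, §31.6 (MODULAR-EXPONENTIATION, loop invariant)] -/
theorem modMulStep_iterate {ℓ : ℕ} (a : ZMod p) {B : ℕ} (hB : B < 2 ^ ℓ) :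
    ∀ m, m ≤ ℓ → (modMulStep ℓ)^[m] (0, B, a) =
      (a * ((B / 2 ^ (ℓ - m) : ℕ) : ZMod p), B * 2 ^ m, a)
  | 0, _ => by simp [Nat.div_eq_of_lt hB]
  | m + 1, hm => by
    rw [Function.iterate_succ_apply', modMulStep_iterate a hB m (Nat.le_of_succ_le hm)]
    set j := ℓ - (m + 1) with hj
    have hj1 : ℓ - m = j + 1 := by omega
    have hbit : (B * 2 ^ m).testBit (ℓ - 1) = B.testBit j := by
      rw [Nat.testBit_mul_two_pow]
      rw [show decide (m ≤ ℓ - 1) = true from decide_eq_true (by omega), Bool.true_and]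
      congr 1
      omega
    have hdiv : B / 2 ^ j = 2 * (B / 2 ^ (j + 1)) + (B.testBit j).toNat := by
      rw [Nat.toNat_testBit, pow_succ, ← Nat.div_div_eq_div_mul]
      exact (Nat.div_add_mod _ 2).symm
    simp only [modMulStep]
    refine Prod.ext ?_ (Prod.ext ?_ rfl)
    · simp only [hbit, hj1, hdiv]
      cases B.testBit j <;> simp <;> ring
    · simp only
      ring

/-- Gate count of the modular multiplier on `ℓ`-bit residues. [folklore] -/
def modMulCost (ℓ : ℕ) : ℕ := ℓ + ℓ * modMulStepCost ℓ

/-- **Modular multiplication** by `ℓ` Horner steps (double-and-add, the additive version of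
CLRS 2009, §31.6 MODULAR-EXPONENTIATION): for `p ≤ 2^ℓ`, the bits of `(a · b) mod p` are computed
from the bits of the residues `a, b` by `modMulCost ℓ = O(ℓ³)` gates. [cite: CLRS2009, §31.6 (MODULAR-EXPONENTIATION)] -/
theorem modMulVia {ℓ : ℕ} (hℓ : p ≤ 2 ^ ℓ) :
    CktSizeVia (zEnc₂ (p := p) ℓ) (fun ab => testBits ℓ (ab.1 * ab.2).val) (modMulCost ℓ) := by
  have hinit : CktSizeVia (zEnc₂ (p := p) ℓ) (fun ab => modMulEnc ℓ ((0 : ZMod p), ab.2.val, ab.1))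
      (Fintype.card (Fin ℓ) * 1 + (0 + 0)) := by
    refine ((CktSizeVia.constRow (zEnc₂ (p := p) ℓ) fun _ : Fin ℓ => false).pair
      ((CktSizeVia.proj (zEnc₂ (p := p) ℓ) Sum.inr).pair
        (CktSizeVia.proj (zEnc₂ (p := p) ℓ) Sum.inl))).congr fun ab => ?_
    simp only [modMulEnc, zEnc₂, ZMod.val_zero, testBits_zero]
    rfl
  have hiter := (cktSizeVia_modMulStep hℓ).iterate ℓ
  have h := (hinit.trans (hiter.reparam fun ab : ZMod p × ZMod p => ((0 : ZMod p), ab.2.val, ab.1))).outMap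
    (Sum.inl : Fin ℓ → Fin ℓ ⊕ (Fin ℓ ⊕ Fin ℓ))
  refine (h.congr fun ab => ?_).of_le (by simp [modMulCost])
  have hB : ab.2.val < 2 ^ ℓ := (ZMod.val_lt _).trans_le hℓ
  funext i
  simp only [modMulEnc, Sum.elim_inl, modMulStep_iterate ab.1 hB ℓ le_rfl, Nat.sub_self, pow_zero,
    Nat.div_one, ZMod.natCast_val, ZMod.cast_id', id_eq]

/-- Modular multiplication of available residues (double-and-add, CLRS 2009, §31.6). [cite: CLRS2009, §31.6] -/
theorem HasBits.mul {ℓ : ℕ} {θ α : Type*} {e : θ → α → Bool} {u v : θ → ZMod p} {s s' : ℕ}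
    (hℓ : p ≤ 2 ^ ℓ) (hu : HasBits ℓ e u s) (hv : HasBits ℓ e v s') :
    HasBits ℓ e (fun t => u t * v t) (s + s' + modMulCost ℓ) :=
  (CktSizeVia.pair hu hv).trans ((modMulVia hℓ).reparam fun t => (u t, v t))

end ModArith

/-! ### A polynomial bound for the gate counts -/

/-- Gate count per simulated arithmetic gate (two operands, each fetched, one scalar constant,
one modular multiplication and one modular addition per operand, plus the initial constant). [folklore] -/
def gateCost (ℓ cz : ℕ) : ℕ := ℓ + 2 * (2 * ℓ + cz + modMulCost ℓ + modAddCost ℓ)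

/-- `gateCost ℓ cz ≤ 2 cz + 65 (ℓ + 2)³`. [folklore] -/
theorem gateCost_le (ℓ cz : ℕ) : gateCost ℓ cz ≤ 2 * cz + 65 * (ℓ + 2) ^ 3 := by
  simp only [gateCost, modMulCost, modMulStepCost, modAddCost]
  ring_nf
  nlinarith [sq_nonneg (ℓ : ℕ), Nat.zero_le ℓ, pow_pos (show 0 < ℓ + 2 by omega) 3]

end Literature.Computability.AlgebraicComplexity

/-! ### Simulation of integer straight-line programs modulo `p` by Boolean circuits -/

namespace Literature.Computability.AlgebraicComplexity

open MvPolynomial Complexity ArithCircuit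

variable {ι τ : Type*} {p : ℕ} [NeZero p] {ℓ cz : ℕ}

/-- The bus after simulating a list of gate values `vals`: the Boolean inputs `x` followed by the
`ℓ` bits of each `aeval (z x) vals[j] mod p`. [folklore] -/
def valBus (ℓ : ℕ) (z : (ι → Bool) → τ → ZMod p) (vals : List (MvPolynomial τ ℤ)) (x : ι → Bool) :
    ι ⊕ (Fin vals.length × Fin ℓ) → Bool :=
  Sum.elim x fun ji => testBits ℓ (aeval (z x) vals[ji.1]).val ji.2

omit [NeZero p] in
/-- Fetching an operand: a variable costs `cz` (hypothesis), a constant `ℓ`, a gate reference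
nothing (or `ℓ` for a junk reference, whose value is `0`). [folklore] -/
theorem hasBits_operandEval (z : (ι → Bool) → τ → ZMod p)
    (hz : ∀ v, CktSize B2 (fun x => testBits ℓ (z x v).val) cz) (vals : List (MvPolynomial τ ℤ))
    (u : Operand ℤ τ) :
    HasBits ℓ (valBus ℓ z vals) (fun x => aeval (z x) (u.eval vals)) (cz + ℓ * 1) := by
  cases u with
  | var v =>
    refine (CktSizeVia.of_le ?_ (Nat.le_add_right _ _))
    exact (CktSizeVia.of_cktSize_inl (hz v) _).congr fun x => by simp [Operand.eval]
  | const c =>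
    refine ((HasBits.const ℓ (valBus ℓ z vals) (c : ZMod p)).congr fun x => ?_).of_le
      (Nat.le_add_left _ _)
    simp [Operand.eval]
  | gate j =>
    by_cases hj : j < vals.length
    · refine (HasBits.ofWires (fun i => Sum.inr (⟨j, hj⟩, i)) fun x i => ?_).of_le (Nat.zero_le _)
      simp [valBus, Operand.eval, List.getD_eq_getElem?_getD, List.getElem?_eq_getElem hj]
    · refine ((HasBits.const ℓ (valBus ℓ z vals) (0 : ZMod p)).congr fun x => ?_).of_le
        (Nat.le_add_left _ _)
      simp [Operand.eval, List.getD_eq_getElem?_getD, List.getElem?_eq_none (not_lt.1 hj)]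

/-- A weighted sum of fetched operands, term by term (Horner-free accumulation). [folklore] -/
theorem hasBits_sumEval (hℓ : p ≤ 2 ^ ℓ) (z : (ι → Bool) → τ → ZMod p)
    (hz : ∀ v, CktSize B2 (fun x => testBits ℓ (z x v).val) cz) (vals : List (MvPolynomial τ ℤ)) :
    ∀ args : List (ℤ × Operand ℤ τ),
      HasBits ℓ (valBus ℓ z vals)
        (fun x => (args.map fun a => (a.1 : ZMod p) * aeval (z x) (a.2.eval vals)).sum)
        (ℓ * 1 + args.length * (ℓ * 1 + (cz + ℓ * 1) + modMulCost ℓ + modAddCost ℓ))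
  | [] => by
    refine ((HasBits.const ℓ (valBus ℓ z vals) (0 : ZMod p)).congr fun x => ?_).of_le
      (Nat.le_add_right _ _)
    simp
  | a :: args => by
    have ht : HasBits ℓ (valBus ℓ z vals) (fun x => (a.1 : ZMod p) * aeval (z x) (a.2.eval vals))
        (ℓ * 1 + (cz + ℓ * 1) + modMulCost ℓ) :=
      (HasBits.const ℓ _ (a.1 : ZMod p)).mul hℓ (hasBits_operandEval z hz vals a.2)
    refine ((ht.add hℓ (hasBits_sumEval hℓ z hz vals args)).congr fun x => ?_).of_le (le_of_eq ?_)
    · simp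
    · simp only [List.length_cons]
      ring

/-- A product of fetched operands, factor by factor. [folklore] -/
theorem hasBits_prodEval (hℓ : p ≤ 2 ^ ℓ) (z : (ι → Bool) → τ → ZMod p)
    (hz : ∀ v, CktSize B2 (fun x => testBits ℓ (z x v).val) cz) (vals : List (MvPolynomial τ ℤ)) :
    ∀ args : List (Operand ℤ τ),
      HasBits ℓ (valBus ℓ z vals)
        (fun x => (args.map fun u => aeval (z x) (u.eval vals)).prod)
        (ℓ * 1 + args.length * ((cz + ℓ * 1) + modMulCost ℓ))
  | [] => by
    refine ((HasBits.const ℓ (valBus ℓ z vals) (1 : ZMod p)).congr fun x => ?_).of_le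
      (Nat.le_add_right _ _)
    simp
  | u :: args => by
    refine (((hasBits_operandEval z hz vals u).mul hℓ (hasBits_prodEval hℓ z hz vals args)).congr
      fun x => ?_).of_le (le_of_eq ?_)
    · simp
    · simp only [List.length_cons]
      ring

/-- **One arithmetic gate** of fan-in at most two is simulated by `gateCost ℓ cz` Boolean gates. [folklore] -/
theorem hasBits_gateEval (hℓ : p ≤ 2 ^ ℓ) (z : (ι → Bool) → τ → ZMod p)
    (hz : ∀ v, CktSize B2 (fun x => testBits ℓ (z x v).val) cz) (vals : List (MvPolynomial τ ℤ))
    (g : Gate ℤ τ) (hg : g.fanIn ≤ 2) :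
    HasBits ℓ (valBus ℓ z vals) (fun x => aeval (z x) (g.eval vals)) (gateCost ℓ cz) := by
  cases g with
  | sum args =>
    have hlen : args.length ≤ 2 := by
      simpa [Gate.fanIn, ArithCircuit.Gate.args] using hg
    refine ((hasBits_sumEval hℓ z hz vals args).congr fun x => ?_).of_le ?_
    · simp [Gate.eval, map_list_sum, List.map_map, Function.comp_def, MvPolynomial.smul_eq_C_mul,
        map_mul]
    · calc ℓ * 1 + args.length * (ℓ * 1 + (cz + ℓ * 1) + modMulCost ℓ + modAddCost ℓ)
          ≤ ℓ * 1 + 2 * (ℓ * 1 + (cz + ℓ * 1) + modMulCost ℓ + modAddCost ℓ) :=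
            Nat.add_le_add_left (Nat.mul_le_mul_right _ hlen) _
        _ = gateCost ℓ cz := by simp only [gateCost]; ring
  | prod args =>
    have hlen : args.length ≤ 2 := by
      simpa [Gate.fanIn, ArithCircuit.Gate.args] using hg
    refine ((hasBits_prodEval hℓ z hz vals args).congr fun x => ?_).of_le ?_
    · simp [Gate.eval, map_list_prod, List.map_map, Function.comp_def]
    · calc ℓ * 1 + args.length * ((cz + ℓ * 1) + modMulCost ℓ)
          ≤ ℓ * 1 + 2 * ((cz + ℓ * 1) + modMulCost ℓ) :=
            Nat.add_le_add_left (Nat.mul_le_mul_right _ hlen) _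
        _ ≤ gateCost ℓ cz := by simp only [gateCost]; nlinarith [Nat.zero_le (modAddCost ℓ)]

/-- **Simulation of a fan-in-two integer straight-line program modulo `p`** (Bürgisser 2000 TCS,
§5 (A3), p. 86: "simulate [the arithmetic operations in `𝔽_{p_n}`] by Boolean circuits"): the
bits of all gate values `aeval (z x) v_j mod p` are computed from `x` by
`(number of gates) · gateCost ℓ cz` Boolean gates. [cite: Burgisser2000TCS, §5 (A3) p. 86] -/
theorem cktSize_valBus (hℓ : p ≤ 2 ^ ℓ) (z : (ι → Bool) → τ → ZMod p)
    (hz : ∀ v, CktSize B2 (fun x => testBits ℓ (z x v).val) cz) :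
    ∀ gs : List (Gate ℤ τ), (∀ g ∈ gs, g.fanIn ≤ 2) →
      CktSize B2 (valBus ℓ z (gateValues gs)) (gs.length * gateCost ℓ cz) := by
  intro gs
  induction gs using List.reverseRecOn with
  | nil =>
    intro _
    refine (((CktSize.id B2 (ι := ι)).outMap (Sum.elim (fun i => i)
      fun ji : Fin (gateValues ([] : List (Gate ℤ τ))).length × Fin ℓ => ji.1.elim0)).congr
        ?_).of_le (Nat.zero_le _)
    rintro x (i | ji)
    · rfl
    · exact ji.1.elim0
  | append_singleton gs g ih =>
    intro hall
    have hgs : ∀ g' ∈ gs, g'.fanIn ≤ 2 := fun g' hg' => hall g' (List.mem_append_left _ hg')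
    have hg : g.fanIn ≤ 2 := hall g (List.mem_append_right _ (List.mem_singleton_self g))
    rw [gateValues_append_singleton]
    set vals := gateValues gs with hvals
    have h1 := (CktSizeVia.of_cktSize_id (ih hgs)).trans (hasBits_gateEval hℓ z hz vals g hg).extend
    have h2 := h1.outMap fun w : ι ⊕ (Fin (vals ++ [g.eval vals]).length × Fin ℓ) =>
      (match w with
        | Sum.inl i => Sum.inl (Sum.inl i)
        | Sum.inr ji => if h : (ji.1 : ℕ) < vals.length then Sum.inl (Sum.inr (⟨ji.1, h⟩, ji.2))
            else Sum.inr ji.2 : (ι ⊕ (Fin vals.length × Fin ℓ)) ⊕ Fin ℓ)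
    refine ((h2.congr fun x => ?_).toCktSize).of_le (le_of_eq ?_)
    · funext w
      rcases w with i | ⟨j, b⟩
      · rfl
      · by_cases h : (j : ℕ) < vals.length
        · simp [valBus, h, List.getElem_append_left h]
        · have hj : (j : ℕ) = vals.length := by
            have := j.2; simp only [List.length_append, List.length_singleton] at this; omega
          simp [valBus, hj]
    · simp only [List.length_append, List.length_singleton]
      ring

/-- **Boolean simulation of an integer circuit modulo `p`** (Bürgisser 2000 TCS, §5 (A3), p. 86;
the `FP/poly` form): if every input residue `z x v ∈ ZMod p` (`p ≤ 2^ℓ`) has `B₂`-circuits of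
size `cz` for its `ℓ` bits, then the `ℓ` bits of the value `aeval (z x) P.eval ∈ ZMod p` of a
fan-in-two integer circuit `P` have `B₂`-circuits of size `(P.size + 1) · gateCost ℓ cz`, a
polynomial in `P.size`, `ℓ`, `cz` (`gateCost_le`). [cite: Burgisser2000TCS, §5 (A3) p. 86] -/
theorem cktSize_testBits_aeval_eval (hℓ : p ≤ 2 ^ ℓ) (z : (ι → Bool) → τ → ZMod p)
    (hz : ∀ v, CktSize B2 (fun x => testBits ℓ (z x v).val) cz) (P : ArithCircuit ℤ τ)
    (h2 : P.IsFanInTwo) :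
    CktSize B2 (fun x => testBits ℓ (aeval (z x) P.eval).val) ((P.size + 1) * gateCost ℓ cz) := by
  have h := (CktSizeVia.of_cktSize_id (cktSize_valBus hℓ z hz P.gates h2)).trans
    (hasBits_operandEval z hz (gateValues P.gates) P.output)
  refine (h.toCktSize.of_le ?_)
  have : cz + ℓ * 1 ≤ gateCost ℓ cz := by simp only [gateCost]; omega
  simp only [ArithCircuit.size]
  nlinarith

end Literature.Computability.AlgebraicComplexity
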